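import Summits.AtomisticToContinuum.Crystallization.Theorems.LayeredLawsSelectHcp.Negative.PeriodicPalmLaw
import Literature.MathematicalPhysics.StatisticalMechanics.PeriodicConfigurationSums

/-!
# Negative knowledge for crux `LayeredLawsSelectHcp` (stmt-AtomisticToContinuum-9226), VIII:
# `E_{P_Q}[h] = e(Q)`; the crux restricted to periodic configurations; kill criteria for polytypes

Part VIII (`--supports stmt-AtomisticToContinuum-9226`). `integral_viewMeasure` (Bochner integration
against `count|(Q − x)` is the absolutely convergent sum over `Q`), `summable_norm_lennardJones_view`
(from `PeriodicConfigurationSums.summable_lennardJones_dist_three`), `tsum_points_eq_tsum_ne` (the root's own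
term is `V_LJ(0) = 0`), whence **`meanRootEnergy_palmLaw : E_{P_Q}[h] = e(Q)`** for EVERY periodic
configuration `Q` of `ℝ³` — the exact identity behind "periodic configurations embed as minimising
candidates among point-stationary laws". Consequences for the crux (`crux_iff` of part I):
**`isRelaxedHcp_of_crux`** — if `LayeredLawsSelectHcp` holds, every separated periodic configuration with
`(1/100)`-good shells at all points, Barlow-like, and with `e(Q) ≤ e*` (a periodic MINIMISER) is, seen from
each motif point, `count|A(hcpStacking a h)` with optimal `(a, h)`: hcp would be the unique layered periodic
minimiser up to congruence; contrapositively **`layeredLawsSelectHcp_false_of_periodic_competitor`** (any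
such minimiser one of whose motif views is not a linear-isometric image of an `hcpStacking a h` — fcc,
dhcp, 9R, … were one to win the `~10⁻⁴|e*|` competition — refutes the crux) and
**`layeredLawsSelectHcp_false_of_bravais_minimiser`** (`not_isRelaxedHcp_addSubgroup`: no additive subgroup
of `ℝ³` is a rotated relaxed hcp, `HcpNotBravais_holds`; so a layered Bravais minimiser — fcc — refutes it,
cf. parts III–V). Translation covariance `goodShell_image_sub`, `barlowLike_image_sub`,
`set_eq_of_count_restrict_eq` on the way. All `[folklore]`.
-/

noncomputable section

namespace Summit.AtomisticToContinuum.Crystallization.Theorems.LayeredLawsSelectHcp.Negative.PeriodicEnergy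

open MeasureTheory Set
open Literature.MathematicalPhysics.StatisticalMechanics Literature.Geometry.DiscreteGeometry
open Summit.AtomisticToContinuum.Crystallization.Theses.PalmUnimodularRigidity (LayeredLawsSelectHcp)
open Summit.AtomisticToContinuum.Crystallization.Theorems.ChargedEnergyGapNegative
  (eStar eStar_le bddBelow_energyPerParticle_lennardJones)
open Summit.AtomisticToContinuum.Crystallization.Theorems.LayeredLawsSelectHcp.Negative.DiracLaws
open Summit.AtomisticToContinuum.Crystallization.Theorems.ChargedEnergyGapNegative.Blocks (zBasis)

/-- Euclidean `3`-space. [folklore] -/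
local notation "E3" => EuclideanSpace ℝ (Fin 3)

variable (Q : PeriodicConfiguration 3)
open Summit.AtomisticToContinuum.Crystallization.Theorems.LayeredLawsSelectHcp.Negative.PeriodicPalmLaw

/-! ## §4 The mean root energy of the Palm law is the energy per particle -/

/-- Bochner integration against a view is a sum over the point set (absolutely summable
integrands). [folklore] -/
theorem integral_viewMeasure (x : E3) (f : E3 → ℝ)
    (hf : Summable fun p : ↥Q.points => ‖f ((p : E3) - x)‖) :
    ∫ y, f y ∂(viewMeasure Q x) = ∑' p : ↥Q.points, f ((p : E3) - x) := by
  haveI : Countable ↥Q.points := (countable_points Q).to_subtype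
  have he : (fun z : E3 => z - x) = ⇑(MeasurableEquiv.subRight x) := rfl
  unfold viewMeasure view
  rw [he, ← map_count_restrict_image _ (countable_points Q), integral_map_equiv,
    count_restrict_eq_sum_dirac (countable_points Q)]
  change ∫ y, f (y - x) ∂(Measure.sum fun i : ↥Q.points => (1 : ENNReal) • Measure.dirac (i : E3)) = _
  have hf' : Summable fun i : ↥Q.points => ((1 : ENNReal)).toReal * ‖f ((i : E3) - x)‖ := by
    simpa using hf
  rw [integral_sum_dirac_eq_tsum (f := fun y : E3 => f (y - x))
    (x := fun i : ↥Q.points => (i : E3)) (fun _ => ENNReal.one_ne_top) hf']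
  simp only [ENNReal.toReal_one, one_smul]

/-- The punctured point set `{y ∈ Q | y ≠ x}` as the complement of `{x}` in the type `Q.points`.
[folklore] -/
def puncturedEquiv {x : E3} (hx : x ∈ Q.points) :
    {y : E3 // y ∈ Q.points ∧ y ≠ x} ≃ {p : ↥Q.points // p ∉ ({⟨x, hx⟩} : Finset ↥Q.points)} where
  toFun y := ⟨⟨y.1, y.2.1⟩, by
    rw [Finset.mem_singleton]
    exact fun h => y.2.2 (congrArg Subtype.val h)⟩
  invFun p := ⟨p.1.1, p.1.2, fun h => p.2 (by
    rw [Finset.mem_singleton]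
    exact Subtype.ext h)⟩
  left_inv _ := rfl
  right_inv _ := rfl

/-- The same, with the complement written as a set. [folklore] -/
def puncturedEquiv' {x : E3} (hx : x ∈ Q.points) :
    {y : E3 // y ∈ Q.points ∧ y ≠ x} ≃ ↥((↑({⟨x, hx⟩} : Finset ↥Q.points) : Set ↥Q.points)ᶜ) where
  toFun y := ⟨⟨y.1, y.2.1⟩, by
    rw [Set.mem_compl_iff, Finset.mem_coe, Finset.mem_singleton]
    exact fun h => y.2.2 (congrArg Subtype.val h)⟩
  invFun p := ⟨p.1.1, p.1.2, fun h => p.2 (by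
    rw [Finset.mem_coe, Finset.mem_singleton]
    exact Subtype.ext h)⟩
  left_inv _ := rfl
  right_inv _ := rfl

/-- The Lennard-Jones interaction of a point of `Q` with all of `Q` is absolutely summable
(`PeriodicConfigurationSums.summable_lennardJones_dist_three`, plus the root's own term). [folklore] -/
theorem summable_norm_lennardJones_view {x : E3} (hx : x ∈ Q.points) :
    Summable fun p : ↥Q.points => ‖lennardJones ‖(p : E3) - x‖‖ := by
  classical
  have h := (Q.summable_lennardJones_dist_three x).abs
  have h1 : Summable fun p : {p : ↥Q.points // p ∉ ({⟨x, hx⟩} : Finset ↥Q.points)} =>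
      ‖lennardJones ‖((p : ↥Q.points) : E3) - x‖‖ := by
    refine (puncturedEquiv Q hx).summable_iff.1 (h.congr fun y => ?_)
    change |lennardJones (dist x y.1)| = ‖lennardJones ‖(y.1 : E3) - x‖‖
    rw [Real.norm_eq_abs, dist_eq_norm, norm_sub_rev]
  exact (Finset.summable_compl_iff _).1 h1

/-- **The root energy integral of a view is the lattice sum** `∑_{p ∈ Q} V_LJ(‖p − x‖)`. [folklore] -/
theorem integral_lennardJones_viewMeasure {x : E3} (hx : x ∈ Q.points) :
    ∫ y, lennardJones ‖y‖ ∂(viewMeasure Q x) = ∑' p : ↥Q.points, lennardJones ‖(p : E3) - x‖ :=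
  integral_viewMeasure Q x (fun y => lennardJones ‖y‖) (summable_norm_lennardJones_view Q hx)

/-- … and, the root's own term being `V_LJ(0) = 0`, it is the punctured sum of
`PeriodicConfiguration.energyPerParticle`. [folklore] -/
theorem tsum_points_eq_tsum_ne {x : E3} (hx : x ∈ Q.points) :
    ∑' p : ↥Q.points, lennardJones ‖(p : E3) - x‖ =
      ∑' y : {y : E3 // y ∈ Q.points ∧ y ≠ x}, lennardJones (dist x y.1) := by
  classical
  have hsum : Summable fun p : ↥Q.points => lennardJones ‖(p : E3) - x‖ :=
    (summable_norm_lennardJones_view Q hx).of_norm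
  rw [← hsum.sum_add_tsum_compl (s := {⟨x, hx⟩}), Finset.sum_singleton]
  have h0 : lennardJones ‖((⟨x, hx⟩ : ↥Q.points) : E3) - x‖ = 0 := by
    change lennardJones ‖x - x‖ = 0
    rw [sub_self, norm_zero, lennardJones_zero]
  rw [h0, zero_add, ← Equiv.tsum_eq (puncturedEquiv' Q hx)]
  refine tsum_congr fun y => ?_
  change lennardJones ‖(y.1 : E3) - x‖ = lennardJones (dist x y.1)
  rw [dist_eq_norm, norm_sub_rev]

/-- **`E_{P_Q}[h] = e(Q)`**: the mean root energy of the Palm law of a periodic configuration is its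
Lennard-Jones energy per particle — the exact identity behind "periodic configurations embed as
point-stationary laws" (no hypothesis: the lattice sums converge absolutely in `ℝ³`). [folklore] -/
theorem meanRootEnergy_palmLaw : meanRootEnergy (palmLaw Q) = Q.energyPerParticle lennardJones := by
  unfold meanRootEnergy PeriodicConfiguration.energyPerParticle
  rw [integral_palmLaw]
  have h : ∀ x ∈ Q.motif, (∫ y, lennardJones ‖y‖ ∂viewMeasure Q x) / 2 =
      (∑' y : {y : E3 // y ∈ Q.points ∧ y ≠ x}, lennardJones (dist x y.1)) / 2 := fun x hx => by
    rw [integral_lennardJones_viewMeasure Q (Q.mem_points_of_mem_motif hx),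
      tsum_points_eq_tsum_ne Q (Q.mem_points_of_mem_motif hx)]
  rw [Finset.sum_congr rfl h, ← Finset.sum_div, mul_inv]
  ring

/-! ## §5 What the crux says about periodic configurations -/

/-- `GoodShell` is translation-covariant. [folklore] -/
theorem goodShell_image_sub {S : Set E3} {p : E3} (x : E3) (h : GoodShell S p) :
    GoodShell ((fun z : E3 => z - x) '' S) (p - x) := by
  obtain ⟨a, h9, h1, T, hT, hclose⟩ := h
  refine ⟨a, h9, h1, T, ?_, hclose⟩
  rw [hT]
  ext z
  simp only [Set.mem_image, Set.mem_setOf_eq]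
  constructor
  · rintro ⟨y, ⟨hy, hne, hd⟩, rfl⟩
    refine ⟨y - x, ⟨⟨y, hy, rfl⟩, fun h => hne (sub_left_injective h), by rwa [dist_sub_right]⟩, ?_⟩
    abel
  · rintro ⟨_, ⟨⟨y, hy, rfl⟩, hne, hd⟩, rfl⟩
    refine ⟨y, ⟨hy, fun h => hne (by rw [h]), by rwa [dist_sub_right] at hd⟩, ?_⟩
    abel

/-- `BarlowLike` is translation-invariant. [folklore] -/
theorem barlowLike_image_sub {S : Set E3} (x : E3) (h : BarlowLike S) :
    BarlowLike ((fun z : E3 => z - x) '' S) := by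
  obtain ⟨s, hs, Φ, hbij, hbond⟩ := h
  refine ⟨s, hs, fun z => Φ z - x, ?_, fun p hp q hq => ?_⟩
  · exact (Set.InjOn.bijOn_image (sub_left_injective.injOn)).comp hbij
  · rw [dist_sub_right]
    exact hbond p hp q hq

/-- Equal counting measures have equal carriers. [folklore] -/
theorem set_eq_of_count_restrict_eq {S T : Set E3}
    (h : (Measure.count : Measure E3).restrict S = (Measure.count : Measure E3).restrict T) :
    S = T := by
  ext x
  have hx := congrArg (fun μ : Measure E3 => μ {x}) h
  simp only [Measure.restrict_apply (measurableSet_singleton x)] at hx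
  by_cases hS : x ∈ S <;> by_cases hT : x ∈ T
  · exact ⟨fun _ => hT, fun _ => hS⟩
  · rw [Set.inter_eq_self_of_subset_left (Set.singleton_subset_iff.2 hS),
      Set.singleton_inter_eq_empty.2 hT, Measure.count_singleton, measure_empty] at hx
    exact absurd hx one_ne_zero
  · rw [Set.inter_eq_self_of_subset_left (Set.singleton_subset_iff.2 hT),
      Set.singleton_inter_eq_empty.2 hS, Measure.count_singleton, measure_empty] at hx
    exact absurd hx.symm one_ne_zero
  · exact ⟨fun h => absurd h hS, fun h => absurd h hT⟩

/-- **No additive subgroup of `ℝ³` is a rotated relaxed hcp crystal** (`HcpNotBravais_holds`): the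
conclusion of the crux fails at `count|L` for every countable… indeed every additive subgroup `L`.
[folklore] -/
theorem not_isRelaxedHcp_addSubgroup (L : AddSubgroup E3) :
    ¬ IsRelaxedHcp ((Measure.count : Measure E3).restrict (L : Set E3)) := by
  rintro ⟨a', h', ha', hh', -, -, -, -, A, -, hEq⟩
  have hset : (L : Set E3) = A '' hcpStacking a' h' := set_eq_of_count_restrict_eq hEq
  have key : ((L.map (A.symm.toLinearEquiv : E3 →ₗ[ℝ] E3).toAddMonoidHom : AddSubgroup E3) : Set E3) =
      hcpStacking a' h' := by
    rw [AddSubgroup.coe_map]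
    change (fun x => A.symm x) '' (L : Set E3) = hcpStacking a' h'
    rw [hset, Set.image_image]
    simp
  exact Literature.Barriers.AtomisticToContinuum.HcpNotBravais_holds a' h' ha' hh' _ key

/-- **The crux restricted to periodic configurations.** If `LayeredLawsSelectHcp` holds then every
periodic configuration of `ℝ³` which is separated, has `(1/100)`-good shells at all its points, is
Barlow-like, and MINIMISES the Lennard-Jones energy per particle (`e(Q) ≤ e*`, i.e. `= e*`) is, seen
from each of its motif points, a rotated relaxed hcp crystal `A(hcpStacking a h)` with optimal
parameters: hcp is then the UNIQUE layered periodic minimiser up to congruence. (Apply the crux to the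
Palm law `P_Q`, which satisfies H1–H4, and read the samples.) [folklore] -/
theorem isRelaxedHcp_of_crux (H : LayeredLawsSelectHcp) {δ : ℝ} (hδ : 0 < δ)
    (hsep : ∀ p ∈ Q.points, ∀ q ∈ Q.points, p ≠ q → δ ≤ dist p q)
    (hshell : ∀ p ∈ Q.points, GoodShell Q.points p) (hbar : BarlowLike Q.points)
    (hE : Q.energyPerParticle lennardJones ≤ eStar) :
    ∀ x ∈ Q.motif, IsRelaxedHcp (viewMeasure Q x) := by
  refine of_ae_palmLaw Q (crux_iff.1 H δ hδ (palmLaw Q) inferInstance (rooted_palmLaw Q hsep)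
    (pointStationary_palmLaw Q) (by rw [meanRootEnergy_palmLaw]; exact hE)
    (ae_palmLaw Q fun x _ => ⟨view Q x, rfl, ?_, barlowLike_image_sub x hbar⟩))
  rintro _ ⟨p, hp, rfl⟩
  exact goodShell_image_sub x (hshell p hp)

/-- **Kill criterion for periodic competitors (contrapositive).** A separated, layered (good shells
everywhere, Barlow-like) periodic configuration minimising the energy per particle, one of whose motif
views is NOT a linear-isometric image of any `hcpStacking a h` (`a, h ≠ 0`) — e.g. fcc, dhcp, 9R or any
other polytype, were it to win the `10⁻⁴` competition — refutes the crux. [folklore] -/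
theorem layeredLawsSelectHcp_false_of_periodic_competitor {δ : ℝ} (hδ : 0 < δ)
    (hsep : ∀ p ∈ Q.points, ∀ q ∈ Q.points, p ≠ q → δ ≤ dist p q)
    (hshell : ∀ p ∈ Q.points, GoodShell Q.points p) (hbar : BarlowLike Q.points)
    (hE : Q.energyPerParticle lennardJones ≤ eStar)
    (hnot : ∃ x ∈ Q.motif, ∀ (a h : ℝ) (A : E3 ≃ₗᵢ[ℝ] E3), a ≠ 0 → h ≠ 0 →
      view Q x ≠ A '' hcpStacking a h) :
    ¬ LayeredLawsSelectHcp := by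
  intro H
  obtain ⟨x, hx, hne⟩ := hnot
  obtain ⟨a, h, ha, hh, -, -, -, -, A, -, hEq⟩ := isRelaxedHcp_of_crux Q H hδ hsep hshell hbar hE x hx
  exact hne a h A ha hh (set_eq_of_count_restrict_eq hEq)

/-- **Kill criterion, Bravais case.** A separated, layered Bravais lattice (point set an additive
subgroup of `ℝ³`, one-point motif at the origin… or any periodic presentation one of whose motif views
is a subgroup carrier) minimising the energy per particle refutes the crux — fcc being the case in
point (parts III–V). [folklore] -/
theorem layeredLawsSelectHcp_false_of_bravais_minimiser {δ : ℝ} (hδ : 0 < δ)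
    (hsep : ∀ p ∈ Q.points, ∀ q ∈ Q.points, p ≠ q → δ ≤ dist p q)
    (hshell : ∀ p ∈ Q.points, GoodShell Q.points p) (hbar : BarlowLike Q.points)
    (hE : Q.energyPerParticle lennardJones ≤ eStar)
    (hL : ∃ x ∈ Q.motif, ∃ L : AddSubgroup E3, (L : Set E3) = view Q x) :
    ¬ LayeredLawsSelectHcp := by
  intro H
  obtain ⟨x, hx, L, hLx⟩ := hL
  have h := isRelaxedHcp_of_crux Q H hδ hsep hshell hbar hE x hx
  unfold viewMeasure at h
  rw [← hLx] at h
  exact not_isRelaxedHcp_addSubgroup L h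

end Summit.AtomisticToContinuum.Crystallization.Theorems.LayeredLawsSelectHcp.Negative.PeriodicEnergy

end
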